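import Summits.BirchSwinnertonDyer.BirchSwinnertonDyer.Statement
import Literature.NumberTheory.EllipticCurves.Selmer
import Literature.NumberTheory.EllipticCurves.BSDSelmer
import Literature.NumberTheory.EllipticCurves.BSDRootNumber
import HarnessLib

/-!
# SoloInformedRankTwo — the first open case of RANK (`r_an = 2`) reduced to two doors

For an elliptic curve `E/ℚ` of analytic rank exactly `2` and a prime `p`, the equality
`rank E(ℚ) = r_an(E) = 2` follows — by counting alone — from three named facts of the tree and
one theorem in print, plus TWO open doors at the same prime:

* facts: the corank identity `corank Sel_{p^∞} = rank + corank Ш[p^∞]`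
  (`selmerCorank_eq_mordellWeilRank_add`; Greenberg, LNM 1716 (1999) §1), the `p`-parity theorem
  `(-1)^{corank Sel_{p^∞}} = w(E)` (`p_parity`; Dokchitser–Dokchitser, Ann. of Math. 172 (2010)
  Thm. 1.4) and the sign of the functional equation `r_an even ↔ w(E) = 1`
  (`even_analyticRank_iff_rootNumber_eq_one`);
* in print under hypotheses (hypothesis `hSU`): `L(E,1) = 0 ⇒ corank Sel_{p^∞}(E/ℚ) ≥ 1`
  (Skinner–Urban, Invent. Math. 195 (2014), Thm. 2 (b), good ordinary `p`, residual
  irreducibility and a ramification hypothesis);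
* door (α) (hypothesis `hα`): `corank Sel_{p^∞}(E/ℚ) ≤ r_an(E)` — by Kato's Thm. 18.4 this is
  implied by `ord_{T=0} L_p(E,T) ≤ 2`, i.e. `L_p''(E,0) ≠ 0` ("p-adic order ≤ complex order");
* door (β) (hypothesis `hβ`): `corank_{ℤ_p} Ш(E/ℚ)[p^∞] = 0`.

`soloInformed_rank_eq_of_analyticRank_eq_two` is the pointwise statement;
`soloInformed_rank_eq_two_of_doors` the universally quantified one. Parity does the work of the
missing second Selmer class: `w = +1` forces the corank to be even, so `≥ 1` becomes `≥ 2`.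
No analogue of this trick exists at `r_an = 3` (corank odd and `≥ 1` does not give `≥ 3`).
-/

noncomputable section

open scoped Classical

open Literature.NumberTheory.EllipticCurves WeierstrassCurve

namespace Summit.BirchSwinnertonDyer.BirchSwinnertonDyer.Theorems

/-- **RANK at analytic rank two, from doors (α) and (β) at one prime.** Let `E/ℚ` (model `W`)
have `r_an(E) = 2` and let `p` be a prime. Assume the corank identity at `p` (Greenberg 1999
§1), `p`-parity (Dokchitser–Dokchitser 2010 Thm. 1.4), the sign relation
`r_an even ↔ w = 1`, the Skinner–Urban-type converse `r_an ≠ 0 ⇒ corank Sel_{p^∞} ≥ 1`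
(Skinner–Urban 2014 Thm. 2), door (α) `corank Sel_{p^∞} ≤ r_an` and door (β)
`corank Ш[p^∞] = 0`. Then `rank E(ℚ) = r_an(E)`. [cite: DokchitserDokchitserAnnals2010, Thm. 1.4] -/
theorem soloInformed_rank_eq_of_analyticRank_eq_two
    (W : WeierstrassCurve ℚ) [W.IsElliptic] (p : ℕ) [Fact p.Prime]
    (h2 : W.analyticRank = 2)
    (hId : W.selmerCorank_eq_mordellWeilRank_add)
    (hPar : p_parity W p)
    (hSign : even_analyticRank_iff_rootNumber_eq_one W)
    (hSU : W.analyticRank ≠ 0 → 1 ≤ W.selmerCorank p)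
    (hα : W.selmerCorank p ≤ W.analyticRank)
    (hβ : W.shaCorank p = 0) :
    W.mordellWeilRank = W.analyticRank := by
  have hid : W.selmerCorank p = W.mordellWeilRank + W.shaCorank p := hId p
  have hS : Even W.analyticRank ↔ W.rootNumber = 1 := @hSign _
  have hw : W.rootNumber = 1 := hS.mp ⟨1, by omega⟩
  have hP : (-1 : ℤ) ^ W.selmerCorank p = W.rootNumber := hPar
  have hpar : (-1 : ℤ) ^ W.selmerCorank p = 1 := hP.trans hw
  have heven : Even (W.selmerCorank p) :=
    (neg_one_pow_eq_one_iff_even (by norm_num)).mp hpar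
  have h1 : 1 ≤ W.selmerCorank p := hSU (by omega)
  obtain ⟨k, hk⟩ := heven
  omega

/-- **The `r_an = 2` case of RANK from the doors, universally.** Over the tree facts
`selmerCorank_eq_mordellWeilRank_add`, `p_parity` and `even_analyticRank_iff_rootNumber_eq_one`
(all curves, all primes): if for every `E/ℚ` with `r_an(E) = 2` there is a prime `p` at which
the Skinner–Urban converse, door (α) `corank Sel_{p^∞} ≤ 2` and door (β) `corank Ш[p^∞] = 0`
hold, then `rank E(ℚ) = 2 = r_an(E)` for every such curve.
[cite: DokchitserDokchitserAnnals2010, Thm. 1.4] -/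
theorem soloInformed_rank_eq_two_of_doors
    (hId : ∀ (W : WeierstrassCurve ℚ), W.selmerCorank_eq_mordellWeilRank_add)
    (hPar : ∀ (W : WeierstrassCurve ℚ) [W.IsElliptic] (p : ℕ) [Fact p.Prime], p_parity W p)
    (hSign : ∀ (W : WeierstrassCurve ℚ), even_analyticRank_iff_rootNumber_eq_one W)
    (hDoors : ∀ (W : WeierstrassCurve ℚ) [W.IsElliptic], W.analyticRank = 2 →
      ∃ (p : ℕ) (_ : Fact p.Prime),
        (W.analyticRank ≠ 0 → 1 ≤ W.selmerCorank p) ∧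
        W.selmerCorank p ≤ W.analyticRank ∧ W.shaCorank p = 0) :
    ∀ (W : WeierstrassCurve ℚ) [W.IsElliptic], W.analyticRank = 2 →
      W.mordellWeilRank = W.analyticRank := by
  intro W hW h2
  obtain ⟨p, hp, hSU, hα, hβ⟩ := hDoors W h2
  exact soloInformed_rank_eq_of_analyticRank_eq_two W p h2 (hId W) (hPar W p) (hSign W) hSU hα hβ

end Summit.BirchSwinnertonDyer.BirchSwinnertonDyer.Theorems

end
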